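import Literature.Analysis.FluidPDE.CKNPressureEstimate
import Literature.Analysis.FluidPDE.CKNLocalRegularityRRSStep3
import HarnessLib

/-!
# The one-scale leaf of the ε-regularity criterion from the first local regularity theorem

Analysis/FluidPDE file in the decomposition of the named fact
`Literature.Analysis.FluidPDE.ckn_epsilon_regularity` (`PartialRegularity.lean`, ns.S12:
Caffarelli–Kohn–Nirenberg 1982, Proposition 2). The proved assembly
`ckn_epsilon_regularity_of_estimates` (`CKNEpsilonRegularityAssembly`) reduces it to four
decomposition targets, three of which are now theorems (`localEnergyEstimate_holds`,
`pressureEstimate_holds`, `interpolationEstimate_holds`). The fourth, `oneScaleRegularity`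
(Caffarelli–Kohn–Nirenberg's Proposition 1 with an absolute `(u, p)`-threshold and a
`q`-dependent force threshold), is the conclusion of the tree's rendering of
Robinson–Rodrigo–Sadowski's first local regularity theorem with force,
`RRS2016.theorem15_3_force` (`CKNLocalRegularityRRS`; itself reduced there and in
`CKNLocalRegularityRRSStep3` to `RRS2016.step2_force` and the named fact `RRS2016.lemma15_12`).
This file proves the glue:

* `IsSuitableWeakSolutionOn.rrs_isSuitablePair` — a suitable weak solution in the sense of
  Caffarelli–Kohn–Nirenberg (2.1)–(2.5) (`IsSuitableWeakSolutionOn`) with a locally integrable,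
  divergence-free force is, on every unit cylinder with `closure Q_1(z₀) ⊆ Q`, a suitable pair in
  the sense of Robinson–Rodrigo–Sadowski's Def. 15.2 (`RRS2016.IsSuitablePair`), the weak
  gradient being the one of the local energy inequality and the pressure equation the accepted
  `IsDistributionalNSSolutionOn.integral_hessian_add_pressure_laplacian_eq_zero_of_iterated`;
* `oneScaleRegularity_of_theorem15_3_force : RRS2016.theorem15_3_force → oneScaleRegularity`
  (zoom `Q_r(z)` to `Q_1(0)` — `C`, `D`, `F_q` are scale invariant —, apply Thm. 15.3 with force
  at `ε₀ = ε⋆`, and transport the a.e. bound on `Q_{1/2}(0)` back to `Q_{r/2}(z)`);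
* hence `ckn_epsilon_regularity_of_theorem15_3_force` and
  `ckn_epsilon_regularity_of_step2_force : RRS2016.step2_force → RRS2016.lemma15_12 →
  ckn_epsilon_regularity` — the ε-regularity criterion of ns.S12 over the two remaining named
  facts of the Robinson–Rodrigo–Sadowski route.

## References

* L. Caffarelli, R. Kohn, L. Nirenberg, *Partial regularity of suitable weak solutions of the
  Navier–Stokes equations*, Comm. Pure Appl. Math. 35 (1982), Propositions 1–2.
* J. C. Robinson, J. L. Rodrigo, W. Sadowski, *The three-dimensional Navier–Stokes equations*,
  Cambridge Studies in Advanced Mathematics 157 (2016), Def. 15.2, Thm. 15.3, Lemma 15.8,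
  proof of Thm. 16.2.
-/

noncomputable section

open MeasureTheory Set Function Filter Topology TopologicalSpace Metric InnerProductSpace Module
open scoped ENNReal NNReal RealInnerProductSpace Laplacian

namespace Literature.Analysis.FluidPDE

/-! ### Tools -/

section Tools

/-- `L^q(Q)` functions, `1 ≤ q`, are locally integrable on the open set `Q`. [folklore] -/
theorem locallyIntegrableOn_of_memLp_ofReal {F : Type*} [NormedAddCommGroup F]
    {g : ℝ × EuclideanSpace ℝ (Fin 3) → F} {Q : Opens (ℝ × EuclideanSpace ℝ (Fin 3))} {q : ℝ}
    (hg : MemLp g (ENNReal.ofReal q) (volume.restrict (Q : Set (ℝ × EuclideanSpace ℝ (Fin 3)))))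
    (hq : 1 ≤ q) :
    LocallyIntegrableOn g (Q : Set (ℝ × EuclideanSpace ℝ (Fin 3))) volume := by
  rw [locallyIntegrableOn_iff Q.isOpen.isLocallyClosed]
  intro K hK hKc
  have h1 : MemLp g (ENNReal.ofReal q) (volume.restrict K) :=
    hg.mono_measure (Measure.restrict_mono hK le_rfl)
  haveI : IsFiniteMeasure (volume.restrict K) := isFiniteMeasure_restrict.2 hKc.measure_lt_top.ne
  have h2 : MemLp g 1 (volume.restrict K) :=
    h1.mono_exponent (by rw [← ENNReal.ofReal_one]; exact ENNReal.ofReal_le_ofReal hq)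
  exact memLp_one_iff_integrable.1 h2

end Tools

/-! ### Suitable weak solutions are suitable pairs on interior unit cylinders -/

section Pair

variable {Q : Opens (ℝ × EuclideanSpace ℝ (Fin 3))} {ν : ℝ}
  {f u : ℝ → EuclideanSpace ℝ (Fin 3) → EuclideanSpace ℝ (Fin 3)}
  {p : ℝ → EuclideanSpace ℝ (Fin 3) → ℝ}

/-- **A suitable weak solution (Caffarelli–Kohn–Nirenberg (2.1)–(2.5)) with a locally integrable
divergence-free force is a suitable pair (Robinson–Rodrigo–Sadowski, Def. 15.2) on every unit
cylinder `Q_1(z₀)` with `closure Q_1(z₀) ⊆ Q`.** The classes come from the energy class, the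
pressure class and the local energy inequality of the structure on the compact set
`closure Q_1(z₀)`; `div u = 0` and the local energy inequality are tested on fewer functions;
the pressure equation is the weak pressure Poisson equation (Lemarié-Rieusset 2016, (13.19),
`IsDistributionalNSSolutionOn.integral_hessian_add_pressure_laplacian_eq_zero_of_iterated`) with
`D²φ(u,u) = ⟪u, (u·∇)∇φ⟫`. [cite: RobinsonRodrigoSadowski2016, Def. 15.2 pp. 212–213] -/
theorem IsSuitableWeakSolutionOn.rrs_isSuitablePair (hsol : IsSuitableWeakSolutionOn Q ν f u p)
    (hfi : LocallyIntegrableOn (uncurry f) (Q : Set (ℝ × EuclideanSpace ℝ (Fin 3))) volume)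
    (hdivf : ∀ φ : ℝ → EuclideanSpace ℝ (Fin 3) → ℝ, IsSpaceTimeTestOn Q φ →
      ∫ t, ∫ x, ⟪f t x, gradient (φ t) x⟫ = 0)
    {z₀ : ℝ × EuclideanSpace ℝ (Fin 3)}
    (hcl : closure (parabolicCylinder 1 z₀) ⊆ (Q : Set (ℝ × EuclideanSpace ℝ (Fin 3)))) :
    ∃ G : ℝ → EuclideanSpace ℝ (Fin 3) → EuclideanSpace ℝ (Fin 3) →L[ℝ] EuclideanSpace ℝ (Fin 3),
      RRS2016.IsSuitablePair (parabolicCylinderOpens 1 z₀) ν f u p G := by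
  set K := closure (parabolicCylinder 1 z₀) with hK
  have hKc : IsCompact K :=
    (isCompact_Icc.prod (isCompact_closedBall _ _)).of_isClosed_subset isClosed_closure
      (closure_parabolicCylinder_subset 1 z₀)
  have hsub : parabolicCylinder 1 z₀ ⊆ (Q : Set (ℝ × EuclideanSpace ℝ (Fin 3))) :=
    subset_closure.trans hcl
  have hle : parabolicCylinderOpens 1 z₀ ≤ Q := hsub
  obtain ⟨G, hG, hGfin, hLEI⟩ := hsol.localEnergy
  have hns := hsol.distributional.of_le hle
  have hf₁ : LocallyIntegrableOn (uncurry f)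
      ((parabolicCylinderOpens 1 z₀ : Opens _) : Set (ℝ × EuclideanSpace ℝ (Fin 3))) volume :=
    hfi.mono_set hsub
  refine ⟨G,
    { energy := ?_
      sq_locallyIntegrableOn := hns.2.1
      weakGradient := hG.mono hle
      gradient_lt_top := (lintegral_mono_set subset_closure).trans_lt (hGfin K hcl hKc)
      pressure_locallyIntegrableOn := hns.2.2.1
      pressure_lt_top := (lintegral_mono_set subset_closure).trans_lt (hsol.pressure K hcl hKc)
      divFree := hns.2.2.2.1
      pressureEq := fun φ hφ => ?_
      localEnergy := fun φ hφ hφ0 => hLEI φ (hφ.mono hle) hφ0 }⟩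
  · obtain ⟨C, hC⟩ := hsol.energyClass K hcl hKc
    refine ⟨C, ?_⟩
    filter_upwards [hC] with t ht
    refine (lintegral_mono fun x => ?_).trans ht
    exact indicator_le_indicator_of_subset subset_closure (fun _ => zero_le) _
  · have key := hns.integral_hessian_add_pressure_laplacian_eq_zero_of_iterated hf₁
      (fun θ hθ => hdivf θ (hθ.mono hle)) hφ
    have hφ2 : ∀ t, ContDiff ℝ 2 (φ t) := fun t => contDiff_infty.1 (hφ.contDiff_slice t) 2
    rw [← key]
    refine setIntegral_congr_fun (isOpen_parabolicCylinder 1 z₀).measurableSet fun w _ => ?_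
    rw [convect, inner_fderiv_gradient_apply (hφ2 w.1)]

end Pair

/-! ### The glue -/

section Glue

set_option maxHeartbeats 800000 in
-- the zoom bookkeeping is long; the bump covers this proof only
/-- **`oneScaleRegularity` from the first local regularity theorem with force.** Zoom `Q_r(z)` to
`Q_1(0)` (`u_r = r u ∘ Φ`, `p_r = r² p ∘ Φ`, `f_r = r³ f ∘ Φ`; the quantities `C`, `D`, `F_q` are
scale invariant and the zoomed solution is again suitable with divergence-free `L^q` force),
apply `RRS2016.theorem15_3_force` on `Q_1(0)` with `ε₀ = ε⋆` (the smallness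
`C(1) + D(1) ≤ ε⋆` is (15.18) and `F_q(1) ≤ (κ(q) ε⋆^{4/9})^q` the force smallness), and transport
the resulting a.e. bound `|u_r| ≤ c_M ε⋆^{1/3}` on `Q_{1/2}(0)` back to
`|u| ≤ c_M ε⋆^{1/3}/r` a.e. on `Q_{r/2}(z)`. [cite: RobinsonRodrigoSadowski2016, Thm. 15.3 and Lemma 15.8] -/
theorem oneScaleRegularity_of_theorem15_3_force (h : RRS2016.theorem15_3_force) :
    oneScaleRegularity := by
  obtain ⟨ε₁, cM, hε₁, hcM, H⟩ := h
  refine ⟨ε₁, hε₁, fun q hq => ?_⟩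
  obtain ⟨κ, hκ, Hq⟩ := H q hq
  have hq0 : 0 ≤ q := by linarith
  have hq1 : 1 ≤ q := by linarith
  refine ⟨(κ * ε₁ ^ (4 / 9 : ℝ)) ^ q, by positivity,
    fun Q f u p hsol hf hdivf z r hr hcl hsmall hforce => ?_⟩
  -- ### the zoomed data
  have hr2 : (0 : ℝ) < r ^ 2 := by positivity
  set Q' := stPreimage (r ^ 2) r z.1 z.2 Q with hQ'
  set u' := r • stPull (r ^ 2) r z.1 z.2 u with hu'
  set p' := r ^ 2 • stPull (r ^ 2) r z.1 z.2 p with hp'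
  set f' := r ^ 3 • stPull (r ^ 2) r z.1 z.2 f with hf'
  have hsol' : IsSuitableWeakSolutionOn Q' 1 f' u' p' := by
    have := hsol.stRescale (α := r) (β := r ^ 2) (γ := r) hr hr (by ring) z.1 z.2
    rwa [show r * 1 / r = 1 by field_simp, show r ^ 2 * r = r ^ 3 by ring] at this
  have hf'' : MemLp (uncurry f') (ENNReal.ofReal q)
      (volume.restrict (Q' : Set (ℝ × EuclideanSpace ℝ (Fin 3)))) :=
    hf.smul_uncurry_stPull hr2 hr z.1 z.2 (r ^ 3)
  have hfi' : LocallyIntegrableOn (uncurry f') (Q' : Set (ℝ × EuclideanSpace ℝ (Fin 3))) volume :=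
    locallyIntegrableOn_of_memLp_ofReal hf'' hq1
  have hdivf' := iterated_inner_gradient_eq_zero_stPull hdivf hr z
  have hcl' := closure_parabolicCylinder_one_subset_stPreimage hr hcl
  -- ### a suitable pair on `Q_1(0)`
  obtain ⟨G₀, hP⟩ := hsol'.rrs_isSuitablePair hfi' hdivf' hcl'
  have hsub : parabolicCylinder 1 (0 : ℝ × EuclideanSpace ℝ (Fin 3)) ⊆
      (Q' : Set (ℝ × EuclideanSpace ℝ (Fin 3))) := subset_closure.trans hcl'
  have hfq : MemLp (uncurry f') (ENNReal.ofReal q)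
      (volume.restrict (parabolicCylinder 1 (0 : ℝ × EuclideanSpace ℝ (Fin 3)))) :=
    hf''.mono_measure (Measure.restrict_mono hsub le_rfl)
  -- ### the scale-invariant quantities
  have hz : stAffine (r ^ 2) r z.1 z.2 (0 : ℝ × EuclideanSpace ℝ (Fin 3)) = z :=
    Prod.ext (by simp [stAffine]) (by simp [stAffine])
  have hC : cknC 1 0 u' = cknC r z u := by
    rw [hu', cknC_nsZoom hr one_pos z.1 z.2 0 u, hz, mul_one]
  have hD : cknD 1 0 p' = cknD r z p := by
    rw [hp', cknD_nsZoom hr one_pos z.1 z.2 0 p, hz, mul_one]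
  have hF : cknF q 1 0 f' = cknF q r z f := by
    rw [hf', cknF_nsZoom hr one_pos hq0 z.1 z.2 0 f, hz, mul_one]
  have hum : AEStronglyMeasurable (uncurry u')
      (volume.restrict (parabolicCylinder 1 (0 : ℝ × EuclideanSpace ℝ (Fin 3)))) :=
    hP.weakGradient.locallyIntegrableOn.aestronglyMeasurable
  have hSmall : RRS2016.Small ε₁ u' p' 0 := by
    unfold RRS2016.Small
    have hm : AEMeasurable (fun w : ℝ × EuclideanSpace ℝ (Fin 3) => ‖u' w.1 w.2‖ₑ ^ (3 : ℕ))
        (volume.restrict (parabolicCylinder 1 (0 : ℝ × EuclideanSpace ℝ (Fin 3)))) := hum.enorm.pow_const _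
    rw [lintegral_add_left' hm]
    have e1 : ∫⁻ w in parabolicCylinder 1 (0 : ℝ × EuclideanSpace ℝ (Fin 3)), ‖u' w.1 w.2‖ₑ ^ (3 : ℕ) =
        cknC 1 0 u' := by
      simp only [cknC, ENNReal.ofReal_one, one_pow, inv_one, one_mul]
    have e2 : ∫⁻ w in parabolicCylinder 1 (0 : ℝ × EuclideanSpace ℝ (Fin 3)), ‖p' w.1 w.2‖ₑ ^ (3 / 2 : ℝ) =
        cknD 1 0 p' := by
      simp only [cknD, ENNReal.ofReal_one, one_pow, inv_one, one_mul]
    rw [e1, e2, hC, hD]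
    exact hsmall
  have hforce' : ∫⁻ w in parabolicCylinder 1 (0 : ℝ × EuclideanSpace ℝ (Fin 3)), ‖f' w.1 w.2‖ₑ ^ q ≤
      ENNReal.ofReal ((κ * ε₁ ^ (4 / 9 : ℝ)) ^ q) := by
    have e3 : ∫⁻ w in parabolicCylinder 1 (0 : ℝ × EuclideanSpace ℝ (Fin 3)), ‖f' w.1 w.2‖ₑ ^ q =
        cknF q 1 0 f' := by
      simp only [cknF, Real.one_rpow, ENNReal.ofReal_one, one_mul]
    rw [e3, hF]
    exact hforce
  -- ### Thm. 15.3 with force on `Q_1(0)` at `ε₀ = ε⋆`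
  have key := Hq 0 f' u' p' G₀ hP hfq ε₁ hε₁ le_rfl hSmall hforce'
  -- ### transport the bound back to `Q_{r/2}(z)`
  have hpre : stAffine (r ^ 2) r z.1 z.2 ⁻¹' parabolicCylinder (r / 2) z =
      parabolicCylinder (1 / 2) (0 : ℝ × EuclideanSpace ℝ (Fin 3)) := by
    rw [show parabolicCylinder (r / 2) z = Ioo (z.1 - (r / 2) ^ 2) z.1 ×ˢ ball z.2 (r / 2) from rfl,
      stAffine_preimage_cylinder hr2 hr, show parabolicCylinder (1 / 2) (0 : ℝ × EuclideanSpace ℝ (Fin 3)) =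
        Ioo ((0 : ℝ) - (1 / 2) ^ 2) 0 ×ˢ ball (0 : EuclideanSpace ℝ (Fin 3)) (1 / 2) from rfl]
    congr 1
    · congr 1
      · field_simp; ring
      · simp
    · rw [sub_self, smul_zero]
      congr 1
      field_simp
  have key' : ∀ᵐ w ∂(volume.restrict (stAffine (r ^ 2) r z.1 z.2 ⁻¹' parabolicCylinder (r / 2) z)),
      r * ‖uncurry u (stAffine (r ^ 2) r z.1 z.2 w)‖ ≤ cM * ε₁ ^ (1 / 3 : ℝ) := by
    rw [hpre]
    filter_upwards [key] with w hw
    have e : ‖u' w.1 w.2‖ = r * ‖uncurry u (stAffine (r ^ 2) r z.1 z.2 w)‖ := by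
      rw [hu', smul_stPull_apply, norm_smul, Real.norm_eq_abs, abs_of_pos hr]
      rfl
    rwa [e] at hw
  have hbound : ∀ᵐ w ∂(volume.restrict (parabolicCylinder (r / 2) z)),
      ‖uncurry u w‖ ≤ cM * ε₁ ^ (1 / 3 : ℝ) / r := by
    have := ae_restrict_of_ae_restrict_preimage_stAffine hr2 hr z.1 z.2
      (P := fun w => r * ‖uncurry u w‖ ≤ cM * ε₁ ^ (1 / 3 : ℝ)) key'
    filter_upwards [this] with w hw
    rw [le_div_iff₀ hr, mul_comm]
    exact hw
  rw [eLpNorm_exponent_top]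
  exact eLpNormEssSup_lt_top_of_ae_bound hbound

/-- **The ε-regularity criterion of ns.S12 from the first local regularity theorem with force**:
`RRS2016.theorem15_3_force → ckn_epsilon_regularity` (the proved assembly
`ckn_epsilon_regularity_of_estimates` with the three discharged estimates
`localEnergyEstimate_holds`, `pressureEstimate_holds`, `interpolationEstimate_holds` and the glue
`oneScaleRegularity_of_theorem15_3_force`). [cite: CaffarelliKohnNirenberg1982, Proposition 2] -/
theorem ckn_epsilon_regularity_of_theorem15_3_force (h : RRS2016.theorem15_3_force) :
    ckn_epsilon_regularity :=
  ckn_epsilon_regularity_of_estimates localEnergyEstimate_holds pressureEstimate_holds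
    interpolationEstimate_holds (oneScaleRegularity_of_theorem15_3_force h)

/-- **The ε-regularity criterion of ns.S12 over the two remaining named facts of the
Robinson–Rodrigo–Sadowski route**: Step 2 of the induction with force (`RRS2016.step2_force`)
and the local pressure estimate Lemma 15.12 (`RRS2016.lemma15_12`) imply
`ckn_epsilon_regularity` (via `RRS2016.theorem15_3_force_of_step2`).
[cite: CaffarelliKohnNirenberg1982, Proposition 2] -/
theorem ckn_epsilon_regularity_of_step2_force (h2 : RRS2016.step2_force)
    (h12 : RRS2016.lemma15_12) : ckn_epsilon_regularity :=
  ckn_epsilon_regularity_of_theorem15_3_force (RRS2016.theorem15_3_force_of_step2 h2 h12)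

end Glue

end Literature.Analysis.FluidPDE
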